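import Summits.Schanuel.Schanuel.Theorems.ZilberEacNewtonEdge
import Summits.Schanuel.Schanuel.Theorems.ZilberEacBranchKernel
import Summits.Schanuel.Schanuel.Theorems.ZilberEacAlgebraicLogTranscendenceParam
import HarnessLib

/-!
# The equimodular class, LXVIII: the NEWTON POLYGON of `F ∈ ℂ[x][y]` at the origin — the first
# edge, its edge polynomial, the substitution datum, and a Bézout element `r ∈ (F, ∂_yF) ∩ ℂ[x]`

HONEST FRAMING.  Cell `pub-schanuel` (Zilber's Exponential-Algebraic Closedness, case ladder;
host summit Schanuel), seat 2, gen 26.  First of the files formalising the existence half of the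
NEWTON–PUISEUX THEOREM (every point of a plane algebraic curve carries an analytically parametrised
branch `x = a + t^e`, `y = b + η(t)`), which — combined with the master theorem of file LXVI —
decides Mantova–Masser's density question for EVERY non-constant fibre curve over a polynomial graph
of degree `≥ 2`.  Contents: **`exists_bezout_derivative`** (`Q` irreducible of positive `t`-degree ⟹
`A Q + B ∂_tQ = C r` with `r ≠ 0`: Gauss's lemma and Bézout over `ℂ(s)`, cleared — the squarefreeness
witness carried through the Newton–Puiseux induction); **`exists_newtonDatum_edge_eq`** (file LIV's
edge datum with the conclusion `Q̃(0, ·) = E` for the full edge polynomial, no simple root assumed);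
**`exists_firstEdge`** (if `F(0, ·)` has the root `0` with multiplicity `m` and some lower row is
nonzero, the steepest edge through `(0, m)`: integers `k, μ ≥ 1` with
`μ m ≤ k·ord₀(f_j) + μ j` for all nonzero rows and equality at some `j₁ < m`), and
**`firstEdge_poly`** (its edge polynomial has degree `m`, top coefficient `f_m(0)`, and a nonzero
coefficient below `m`).  [folklore (Newton–Puiseux), made concrete]; nothing here is specific to
Schanuel's conjecture (neither used nor implied); Mantova–Masser's question (PLMS 2024 §1 p. 5) and
EC(3,2) stay OPEN.
-/

noncomputable section

open Polynomial

set_option linter.dupNamespace false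

namespace Summit.Schanuel.Schanuel.Theorems

/-! ## Part A. A Bézout element for an irreducible polynomial and its derivative -/

/-- **`A·Q + B·∂_tQ = r(s) ≠ 0`** for an irreducible `Q ∈ ℂ[s][t]` of positive `t`-degree (Gauss's
lemma: `Q` stays irreducible over `ℂ(s)`; `Q ∤ ∂_tQ`; Bézout in `ℂ(s)[t]`, denominators cleared).
[folklore] -/
theorem exists_bezout_derivative {Q : ℂ[X][X]} (hQirr : Irreducible Q) (hQ1 : Q.natDegree ≠ 0) :
    ∃ (A B : ℂ[X][X]) (r : ℂ[X]), r ≠ 0 ∧ A * Q + B * derivative Q = Polynomial.C r := by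
  classical
  have hprim : Q.IsPrimitive := hQirr.isPrimitive hQ1
  have hQk : Irreducible (Q.map (algebraMap ℂ[X] (RatFunc ℂ))) :=
    (hprim.irreducible_iff_irreducible_map_fraction_map (K := RatFunc ℂ)).1 hQirr
  have hndvd : ¬ Q ∣ derivative Q := not_dvd_derivative_of_natDegree_ne_zero hQ1
  have hndvdk : ¬ Q.map (algebraMap ℂ[X] (RatFunc ℂ)) ∣ (derivative Q).map (algebraMap ℂ[X] (RatFunc ℂ)) :=
    fun h => hndvd (hprim.dvd_of_fraction_map_dvd_fraction_map h)
  obtain ⟨A, B, hAB⟩ := (hQk.coprime_iff_not_dvd).2 hndvdk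
  obtain ⟨c, hc, hA⟩ := IsLocalization.integerNormalization_spec (nonZeroDivisors ℂ[X]) A
  obtain ⟨d, hd, hB⟩ := IsLocalization.integerNormalization_spec (nonZeroDivisors ℂ[X]) B
  set A₀ := IsLocalization.integerNormalization (nonZeroDivisors ℂ[X]) A with hA₀
  set B₀ := IsLocalization.integerNormalization (nonZeroDivisors ℂ[X]) B with hB₀
  have hc0 : c ≠ 0 := nonZeroDivisors.ne_zero hc
  have hd0 : d ≠ 0 := nonZeroDivisors.ne_zero hd
  have hinj : Function.Injective (algebraMap ℂ[X] (RatFunc ℂ)) := IsFractionRing.injective _ _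
  refine ⟨Polynomial.C d * A₀, Polynomial.C c * B₀, c * d, mul_ne_zero hc0 hd0, ?_⟩
  apply Polynomial.map_injective (algebraMap ℂ[X] (RatFunc ℂ)) hinj
  rw [Polynomial.map_add, Polynomial.map_mul, Polynomial.map_mul, Polynomial.map_mul,
    Polynomial.map_mul, Polynomial.map_C, Polynomial.map_C, Polynomial.map_C, hA, hB,
    Algebra.smul_def, Algebra.smul_def, Polynomial.algebraMap_apply, Polynomial.algebraMap_apply,
    map_mul, Polynomial.C_mul]
  linear_combination (Polynomial.C (algebraMap ℂ[X] (RatFunc ℂ) c) *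
    Polynomial.C (algebraMap ℂ[X] (RatFunc ℂ) d)) * hAB

/-! ## Part B. The substitution datum of an edge, with the full edge polynomial -/

/-- **The Newton–Puiseux datum of an edge** (file LIV's `exists_newtonDatum_edge` with the
conclusion `Q̃(0, ·) = E` for the FULL edge polynomial `E`; no root of `E` is assumed): if
`ν ≤ k·mult_a(q_j) + μ j` for all nonzero rows, then `Q(a + t^k)(t^μ w) = t^ν Q̃(t)(w)` for all
`t, w`, with `Q̃(0)(·) = E = Σ_{edge} C((q_j/(s-a)^{m_j})(a)) X^j`. [folklore (Newton–Puiseux)] -/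
theorem exists_newtonDatum_edge_eq (Q : Polynomial (Polynomial ℂ)) (a : ℂ) {k μ ν : ℕ} (hk : 1 ≤ k)
    (hedge : ∀ j, Q.coeff j ≠ 0 → ν ≤ k * Polynomial.rootMultiplicity a (Q.coeff j) + μ * j) :
    ∃ Qt : Polynomial (Polynomial ℂ),
      Qt.map (Polynomial.evalRingHom 0) =
        ∑ j ∈ (Finset.range (Q.natDegree + 1)).filter (fun j => Q.coeff j ≠ 0 ∧
          k * Polynomial.rootMultiplicity a (Q.coeff j) + μ * j = ν),
          Polynomial.C ((Q.coeff j /ₘ (Polynomial.X - Polynomial.C a) ^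
            Polynomial.rootMultiplicity a (Q.coeff j)).eval a) * Polynomial.X ^ j ∧
      ∀ t w : ℂ, (Q.map (Polynomial.evalRingHom (a + t ^ k))).eval (t ^ μ * w) =
        t ^ ν * (Qt.map (Polynomial.evalRingHom t)).eval w := by
  classical
  set r := Q.natDegree with hr
  set m : ℕ → ℕ := fun j => Polynomial.rootMultiplicity a (Q.coeff j) with hm
  set s : ℕ → Polynomial ℂ := fun j => Q.coeff j /ₘ (Polynomial.X - Polynomial.C a) ^ m j with hs
  have hfac : ∀ j, Q.coeff j = (Polynomial.X - Polynomial.C a) ^ m j * s j := fun j =>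
    (Polynomial.pow_mul_divByMonic_rootMultiplicity_eq (Q.coeff j) a).symm
  -- the polynomial `Q̃`
  set c : ℕ → Polynomial ℂ := fun j =>
    if Q.coeff j = 0 then 0
    else Polynomial.X ^ (k * m j + μ * j - ν) * (s j).comp (Polynomial.C a + Polynomial.X ^ k) with hc
  set Qt : Polynomial (Polynomial ℂ) := ∑ j ∈ Finset.range (r + 1), Polynomial.monomial j (c j) with hQt
  have hcoefQt : ∀ j, Qt.coeff j = if j < r + 1 then c j else 0 := by
    intro j
    rw [hQt, Polynomial.finsetSum_coeff]
    simp only [Polynomial.coeff_monomial, Finset.sum_ite_eq', Finset.mem_range]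
  have hQtdeg : Qt.natDegree < r + 1 := by
    refine Nat.lt_succ_of_le (Polynomial.natDegree_sum_le_of_forall_le _ _ fun j hj => ?_)
    exact (Polynomial.natDegree_monomial_le _).trans (Nat.lt_succ_iff.1 (Finset.mem_range.1 hj))
  have hc0 : ∀ j, (c j).eval 0 = if Q.coeff j ≠ 0 ∧ k * m j + μ * j = ν then (s j).eval a else 0 := by
    intro j
    simp only [hc]
    by_cases hq : Q.coeff j = 0
    · rw [if_pos hq, if_neg (fun h => h.1 hq), Polynomial.eval_zero]
    · rw [if_neg hq]
      have hν' : ν ≤ k * m j + μ * j := hedge j hq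
      by_cases hν : k * m j + μ * j = ν
      · rw [if_pos ⟨hq, hν⟩, hν, Nat.sub_self, pow_zero, one_mul, Polynomial.eval_comp, Polynomial.eval_add,
          Polynomial.eval_C, Polynomial.eval_pow, Polynomial.eval_X, zero_pow (by omega : k ≠ 0), add_zero]
      · rw [if_neg (fun h => hν h.2), Polynomial.eval_mul, Polynomial.eval_pow, Polynomial.eval_X,
          zero_pow (by omega), zero_mul]
  refine ⟨Qt, ?_, fun t w => ?_⟩
  · ext j
    rw [Polynomial.coeff_map, Polynomial.coe_evalRingHom, hcoefQt, Polynomial.finsetSum_coeff]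
    simp only [Polynomial.coeff_C_mul_X_pow]
    rw [Finset.sum_ite_eq]
    simp only [Finset.mem_filter, Finset.mem_range]
    by_cases hj : j < r + 1
    · rw [if_pos hj, hc0]
      by_cases hcond : Q.coeff j ≠ 0 ∧ k * m j + μ * j = ν
      · rw [if_pos hcond, if_pos ⟨hj, hcond⟩]
      · rw [if_neg hcond, if_neg (fun h => hcond h.2)]
    · rw [if_neg hj, Polynomial.eval_zero, if_neg (fun h => hj h.1)]
  · rw [evalPP_eq_sum Q _ _ (Nat.lt_succ_self _), evalPP_eq_sum Qt t w hQtdeg, Finset.mul_sum]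
    refine Finset.sum_congr rfl fun j hj => ?_
    rw [hcoefQt, if_pos (Finset.mem_range.1 hj)]
    simp only [hc]
    by_cases hq : Q.coeff j = 0
    · rw [if_pos hq, hq]; simp
    · rw [if_neg hq]
      have hν : ν ≤ k * m j + μ * j := hedge j hq
      have hpow : (t ^ k) ^ m j * (t ^ μ) ^ j = t ^ ν * t ^ (k * m j + μ * j - ν) := by
        rw [← pow_mul, ← pow_mul, ← pow_add, ← pow_add, Nat.add_sub_cancel' hν]
      conv_lhs => rw [hfac j]
      simp only [Polynomial.eval_mul, Polynomial.eval_pow, Polynomial.eval_sub, Polynomial.eval_X,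
        Polynomial.eval_C, add_sub_cancel_left, Polynomial.eval_comp, Polynomial.eval_add, mul_pow]
      linear_combination ((s j).eval (a + t ^ k) * w ^ j) * hpow

/-! ## Part C. The first edge of the Newton polygon at the origin -/

/-- **The steepest edge through `(0, m)`.**  If the rows `f_j = F.coeff j` vanish at `0` for
`j < m`, `f_m(0) ≠ 0`, and some `f_j` with `j < m` is nonzero, then there are `k, μ ≥ 1` with
`μ m ≤ k·ord₀(f_j) + μ j` for every nonzero row and equality at some `j₁ < m` with `f_{j₁} ≠ 0`
(`μ/k = min_{j<m} ord₀(f_j)/(m - j)`). [folklore (Newton polygon)] -/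
theorem exists_firstEdge (F : ℂ[X][X]) {m : ℕ} (hlow : ∀ j < m, (F.coeff j).IsRoot 0)
    (hex : ∃ j < m, F.coeff j ≠ 0) :
    ∃ k μ : ℕ, 1 ≤ k ∧ 1 ≤ μ ∧
      (∀ j, F.coeff j ≠ 0 → μ * m ≤ k * Polynomial.rootMultiplicity 0 (F.coeff j) + μ * j) ∧
      ∃ j₁, j₁ < m ∧ F.coeff j₁ ≠ 0 ∧ k * Polynomial.rootMultiplicity 0 (F.coeff j₁) + μ * j₁ = μ * m := by
  classical
  set o : ℕ → ℕ := fun j => Polynomial.rootMultiplicity 0 (F.coeff j) with ho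
  set S : Finset ℕ := (Finset.range m).filter (fun j => F.coeff j ≠ 0) with hS
  have hSne : S.Nonempty := by
    obtain ⟨j, hj, hj0⟩ := hex
    exact ⟨j, Finset.mem_filter.2 ⟨Finset.mem_range.2 hj, hj0⟩⟩
  obtain ⟨j₁, hj₁S, hmin⟩ := Finset.exists_min_image S (fun j => (o j : ℚ) / ((m : ℚ) - j)) hSne
  obtain ⟨hj₁m, hj₁0⟩ := Finset.mem_filter.1 hj₁S
  rw [Finset.mem_range] at hj₁m
  have ho₁ : 1 ≤ o j₁ := (Polynomial.rootMultiplicity_pos hj₁0).2 (hlow j₁ hj₁m)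
  refine ⟨m - j₁, o j₁, by omega, ho₁, fun j hj => ?_, j₁, hj₁m, hj₁0, ?_⟩
  · rcases le_or_gt m j with hmj | hmj
    · nlinarith
    · have hjS : j ∈ S := Finset.mem_filter.2 ⟨Finset.mem_range.2 hmj, hj⟩
      have h := hmin j hjS
      have hmj₁ : (0 : ℚ) < (m : ℚ) - j₁ := by
        have : (j₁ : ℚ) < m := by exact_mod_cast hj₁m
        linarith
      have hmj' : (0 : ℚ) < (m : ℚ) - j := by
        have : (j : ℚ) < m := by exact_mod_cast hmj
        linarith
      rw [div_le_div_iff₀ hmj₁ hmj'] at h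
      -- `o j₁ · (m - j) ≤ o j · (m - j₁)` over `ℚ`, hence over `ℕ`
      have hnat : o j₁ * (m - j) ≤ o j * (m - j₁) := by
        have h' : ((o j₁ : ℚ)) * ((m : ℚ) - j) ≤ (o j : ℚ) * ((m : ℚ) - j₁) := h
        have e1 : ((m - j : ℕ) : ℚ) = (m : ℚ) - j := by push_cast [Nat.cast_sub hmj.le]; ring
        have e2 : ((m - j₁ : ℕ) : ℚ) = (m : ℚ) - j₁ := by push_cast [Nat.cast_sub hj₁m.le]; ring
        have : ((o j₁ * (m - j) : ℕ) : ℚ) ≤ ((o j * (m - j₁) : ℕ) : ℚ) := by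
          push_cast [Nat.cast_sub hmj.le, Nat.cast_sub hj₁m.le]
          linarith
        exact_mod_cast this
      have e3 : o j₁ * m = o j₁ * (m - j) + o j₁ * j := by
        rw [← Nat.mul_add, Nat.sub_add_cancel hmj.le]
      change o j₁ * m ≤ (m - j₁) * o j + o j₁ * j
      rw [e3, mul_comm (m - j₁)]
      exact Nat.add_le_add_right hnat _
  · change (m - j₁) * o j₁ + o j₁ * j₁ = o j₁ * m
    have : (m - j₁) * o j₁ + o j₁ * j₁ = o j₁ * ((m - j₁) + j₁) := by ring
    rw [this, Nat.sub_add_cancel hj₁m.le]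

/-- **The first edge polynomial**: with `k, μ` as in `exists_firstEdge` (`f_m(0) ≠ 0`), the edge
polynomial `E = Σ_{edge} C((f_j / s^{ord f_j})(0)) X^j` has `E.coeff m = f_m(0) ≠ 0`,
`E.coeff j = 0` for `j > m`, and `E.coeff j₁ ≠ 0` at the index `j₁ < m` of equality.
[folklore (Newton polygon)] -/
theorem firstEdge_poly (F : ℂ[X][X]) {m k μ : ℕ} (hμ : 1 ≤ μ) (htop : ¬ (F.coeff m).IsRoot 0)
    {j₁ : ℕ} (hj₁0 : F.coeff j₁ ≠ 0)
    (hj₁ : k * Polynomial.rootMultiplicity 0 (F.coeff j₁) + μ * j₁ = μ * m) :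
    let E : Polynomial ℂ := ∑ j ∈ (Finset.range (F.natDegree + 1)).filter (fun j => F.coeff j ≠ 0 ∧
        k * Polynomial.rootMultiplicity 0 (F.coeff j) + μ * j = μ * m),
        Polynomial.C ((F.coeff j /ₘ (Polynomial.X - Polynomial.C 0) ^
          Polynomial.rootMultiplicity 0 (F.coeff j)).eval 0) * Polynomial.X ^ j
    E.coeff m = (F.coeff m).eval 0 ∧ (∀ j, m < j → E.coeff j = 0) ∧ E.coeff j₁ ≠ 0 ∧
      E.natDegree = m ∧ E ≠ 0 := by
  classical
  intro E
  have hcoef : ∀ j, E.coeff j = if (j < F.natDegree + 1 ∧ (F.coeff j ≠ 0 ∧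
      k * Polynomial.rootMultiplicity 0 (F.coeff j) + μ * j = μ * m)) then
      (F.coeff j /ₘ (Polynomial.X - Polynomial.C 0) ^ Polynomial.rootMultiplicity 0 (F.coeff j)).eval 0
      else 0 := by
    intro j
    simp only [E, Polynomial.finsetSum_coeff, Polynomial.coeff_C_mul_X_pow]
    rw [Finset.sum_ite_eq]
    simp only [Finset.mem_filter, Finset.mem_range]
  have hmem : ∀ j, F.coeff j ≠ 0 → j < F.natDegree + 1 := fun j hj =>
    Nat.lt_succ_of_le (Polynomial.le_natDegree_of_ne_zero hj)
  have hFm0 : F.coeff m ≠ 0 := fun h => htop (by rw [h]; simp)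
  have hom : Polynomial.rootMultiplicity 0 (F.coeff m) = 0 := Polynomial.rootMultiplicity_eq_zero htop
  have hEm : E.coeff m = (F.coeff m).eval 0 := by
    rw [hcoef, if_pos ⟨hmem m hFm0, hFm0, by rw [hom, mul_zero, zero_add]⟩, hom, pow_zero,
      Polynomial.divByMonic_one]
  have hEgt : ∀ j, m < j → E.coeff j = 0 := by
    intro j hj
    rw [hcoef, if_neg]
    rintro ⟨-, -, h⟩
    have : μ * m < μ * j := Nat.mul_lt_mul_of_pos_left hj hμ
    omega
  have hEj₁ : E.coeff j₁ ≠ 0 := by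
    rw [hcoef, if_pos ⟨hmem j₁ hj₁0, hj₁0, hj₁⟩]
    exact Polynomial.eval_divByMonic_pow_rootMultiplicity_ne_zero 0 hj₁0
  have hEm0 : E.coeff m ≠ 0 := by rw [hEm]; exact htop
  have hdeg : E.natDegree = m := by
    refine le_antisymm ?_ (Polynomial.le_natDegree_of_ne_zero hEm0)
    rw [Polynomial.natDegree_le_iff_coeff_eq_zero]
    intro j hj
    exact hEgt j (by exact_mod_cast hj)
  exact ⟨hEm, hEgt, hEj₁, hdeg, fun h => hEm0 (by rw [h, Polynomial.coeff_zero])⟩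

end Summit.Schanuel.Schanuel.Theorems
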